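import Summits.AtomisticToContinuum.FouriersLaw.Theorems.BondHeatUncertaintySubdiffusiveBondHeatKernelGibbsF
import Summits.AtomisticToContinuum.FouriersLaw.Theorems.BondHeatUncertaintySubdiffusiveBondHeatGibbsMomentumFourthMoment

/-!
# Equilibrium two-observable correlations of the pinned chain at fixed length: exponential
decorrelation, measurability and integrability in time

Support file for the items `PhononMeanFreePath.CoherentDephasingWeakCoupling`
(stmt-AtomisticToContinuum-11813) and `PhononMeanFreePath.CoherentDephasing`
(stmt-AtomisticToContinuum-11810), whose object is the pair correlation
`r_N(t) = ∫ p₀ · (K_t p_N) dμ_T` of the `(N+1)`-site chain `pinnedChain ω₂ lam β γ` with both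
Langevin baths at temperature `T` (`K_t` the constructed transition kernels, `μ_T` the Gibbs
measure). Everything here is a FIXED-LENGTH statement for the `n`-site chain (`n ≥ 1`, `ω₂, β, γ, T > 0`,
`lam ≥ 0`) and general continuous observables `a` (weight) and `g` (propagated observable) dominated by
`e^{ϑH}` with `0 < ϑ`, `2ϑ < 1/T`:

* `pinnedChain_corr_exp_decay` — **exponential decorrelation**
  `|∫ a (K_u g) dμ_T - (∫ a dμ_T)(∫ g dμ_T)| ≤ C e^{-cu}` (`u ≥ 0`, `c > 0`; constants depend on `n`):
  CEHR 2018 Thm 2.13 (3) with the limit identified as `μ_T` (`pinnedChain_exp_convergence_gibbs`,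
  Harris' theorem, proved in the tree), integrated against `|a| e^{ϑH} ∈ L¹(μ_T)`;
* `pinnedChain_integrable_weight_mul_act` — `a · (K_u g) ∈ L¹(μ_T)`;
* `pinnedChain_measurable_corr` — `u ↦ ∫ a (K_{u⁺} g) dμ_T` is measurable (joint measurability of the
  kernels in `(t, z)`);
* `pinnedChain_corr_integrableOn`, `pinnedChain_corr_sq_integrableOn` — for centred `g`
  (`∫ g dμ_T = 0`) the correlation and its square are integrable on `(0, ∞)`;
* static Gibbs inputs: `∫ p_j dμ_T = 0` (momentum reversal), `∫ p_j² dμ_T = T` (Gaussian integration by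
  parts), `|p_j| ≤ (1/2 + 1/ϑ) e^{ϑH}`.

The momentum specialisation (`a = p_i`, `g = p_j`) and the consequences for the two items are in the
companion file `PhononMeanFreePathCoherentDephasingWeakCouplingIntegrability.lean`. Nothing here is
uniform in the length `n`.

## References

* N. Cuneo, J.-P. Eckmann, M. Hairer, L. Rey-Bellet, *Non-equilibrium steady states for networks
  of oscillators*, Electron. J. Probab. 23 (2018) no. 55, Thm 2.13 (3) and §3.1.
-/

noncomputable section

open MeasureTheory ProbabilityTheory Filter Topology Set
open scoped NNReal ENNReal

namespace Summit.AtomisticToContinuum.FouriersLaw.Theorems.CoherentDephasing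

open Literature.MathematicalPhysics.KineticTheory.HeatConduction
open Literature.MathematicalPhysics.KineticTheory Literature.Probability.Process OscillatorChain
open Summit.AtomisticToContinuum.FouriersLaw.Theorems.SubdiffusiveBondHeat

/-! ### Static Gibbs inputs: `∫ p_j dμ_T = 0`, `∫ p_j² dμ_T = T`, `|p_j| = O(e^{ϑH})` -/

section Static

variable {ω₂ lam β γ : ℝ}

/-- The Gibbs mean of every momentum vanishes: `∫ p_j dμ_T = 0` (the Gibbs density is even under the
momentum reversal `(q, p) ↦ (q, -p)`, which preserves Lebesgue measure; no integrability needed — both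
sides are Bochner junk `0` otherwise). [folklore] -/
theorem pinnedChain_integral_momentum_gibbsMeasure (n : ℕ) (T : ℝ) (j : Fin n) :
    ∫ z, z.2 j ∂((pinnedChain ω₂ lam β γ).gibbsMeasure n T) = 0 := by
  rw [(pinnedChain ω₂ lam β γ).integral_gibbsMeasure]
  have h := integral_comp_momentumReversal n fun x =>
    x.2 j * (pinnedChain ω₂ lam β γ).gibbsDensity n T x
  simp only [OscillatorChain.gibbsDensity, OscillatorChain.hamiltonian_neg_momentum, Pi.neg_apply,
    neg_mul, integral_neg] at h
  have h0 : ∫ x, x.2 j * (pinnedChain ω₂ lam β γ).gibbsDensity n T x = 0 := by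
    simp only [OscillatorChain.gibbsDensity]
    linarith
  rw [h0, mul_zero]

/-- The Gibbs second moment of every momentum is the temperature: `∫ p_j² dμ_T = T` for `ω₂ > 0`,
`lam, β ≥ 0`, `T > 0` (Gaussian integration by parts in `p_j`,
`pinnedChain_integral_momentum_pow_add_two` at `k = 0`). [folklore] -/
theorem pinnedChain_integral_momentum_sq_gibbsMeasure (hω : 0 < ω₂) (hl : 0 ≤ lam) (hβ : 0 ≤ β)
    (n : ℕ) {T : ℝ} (hT : 0 < T) (j : Fin n) :
    ∫ z, z.2 j ^ 2 ∂((pinnedChain ω₂ lam β γ).gibbsMeasure n T) = T := by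
  haveI : IsProbabilityMeasure ((pinnedChain ω₂ lam β γ).gibbsMeasure n T) :=
    pinnedChain_isProbabilityMeasure_gibbsMeasure hω hl hβ γ n hT
  have h1 : (∫ x, (pinnedChain ω₂ lam β γ).gibbsDensity n T x)⁻¹ *
      ∫ x, (pinnedChain ω₂ lam β γ).gibbsDensity n T x = 1 := by
    have := (pinnedChain ω₂ lam β γ).integral_gibbsMeasure (N := n) (T := T) (fun _ => (1 : ℝ))
    simp only [one_mul, integral_const, probReal_univ, smul_eq_mul, mul_one] at this
    exact this.symm
  rw [(pinnedChain ω₂ lam β γ).integral_gibbsMeasure]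
  have h := pinnedChain_integral_momentum_pow_add_two hω hl hβ γ n hT j (k := 0) (by norm_num)
  simp only [zero_add, pow_zero, one_mul, Nat.cast_zero, mul_one] at h
  rw [h, mul_comm T, ← mul_assoc, h1, one_mul]

/-- `|p_j| ≤ (1/2 + 1/ϑ) e^{ϑH}` for `ϑ > 0` (`|p| ≤ (1 + p²)/2`, `p_j² ≤ 2H ≤ (2/ϑ) e^{ϑH}`,
`1 ≤ e^{ϑH}`), `ω₂, lam, β ≥ 0`. [folklore] -/
theorem abs_momentum_le_exp (hω : 0 ≤ ω₂) (hl : 0 ≤ lam) (hβ : 0 ≤ β) {ϑ : ℝ} (hϑ : 0 < ϑ) {n : ℕ}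
    (z : PhaseSpace n) (j : Fin n) :
    |z.2 j| ≤ (1 / 2 + 1 / ϑ) * Real.exp (ϑ * (pinnedChain ω₂ lam β γ).hamiltonian n z) := by
  set Hz := (pinnedChain ω₂ lam β γ).hamiltonian n z
  have hH := pinnedChain_harmonic_le_hamiltonian (ω₂ := ω₂) hl hβ γ n z
  have h1 : 0 ≤ ∑ i, ω₂ * z.1 i ^ 2 / 2 := Finset.sum_nonneg fun i _ => by positivity
  have h2 : z.2 j ^ 2 / 2 ≤ ∑ i, z.2 i ^ 2 / 2 :=
    Finset.single_le_sum (f := fun i => z.2 i ^ 2 / 2) (fun i _ => by positivity) (Finset.mem_univ _)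
  have hp : z.2 j ^ 2 ≤ 2 * Hz := by linarith
  have hH0 : 0 ≤ Hz := by nlinarith [sq_nonneg (z.2 j)]
  have hexp : ϑ * Hz + 1 ≤ Real.exp (ϑ * Hz) := Real.add_one_le_exp _
  have hE1 : 1 ≤ Real.exp (ϑ * Hz) := Real.one_le_exp (by positivity)
  have hHle : Hz ≤ Real.exp (ϑ * Hz) / ϑ := by
    rw [le_div_iff₀ hϑ]; nlinarith
  have habs : |z.2 j| ≤ (1 + z.2 j ^ 2) / 2 := abs_le_half_one_add_sq (z.2 j)
  calc |z.2 j| ≤ (1 + 2 * Hz) / 2 := by linarith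
    _ ≤ (Real.exp (ϑ * Hz) + 2 * (Real.exp (ϑ * Hz) / ϑ)) / 2 := by gcongr
    _ = (1 / 2 + 1 / ϑ) * Real.exp (ϑ * Hz) := by ring

end Static

/-! ### Two-observable equilibrium correlations `∫ a · (K_u g) dμ_T` of the `n`-site chain -/

section Corr

variable {ω₂ lam β γ : ℝ} (hω : 0 < ω₂) (hl : 0 ≤ lam) (hβ : 0 < β) (hγ : 0 < γ) {n : ℕ} (hn : 0 < n)
  {T : ℝ} (hT : 0 < T)
include hω hl hβ hγ hn hT

/-- **Exponential decorrelation at fixed length.** For the `n`-site pinned chain (`ω₂, β, γ, T > 0`,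
`lam ≥ 0`, `n ≥ 1`), `0 < ϑ` with `2ϑ < 1/T`, and continuous observables `a`, `g` with
`|a| ≤ M_a e^{ϑH}`, `|g| ≤ M_g e^{ϑH}`, there are `C` and `c > 0` with
`|∫ a (K_u g) dμ_T - (∫ a dμ_T)(∫ g dμ_T)| ≤ C e^{-cu}` for all `u ≥ 0`: exponential convergence of
`K_u g(z)` to `μ_T(g)` with weight `e^{ϑH(z)}` (CEHR (2.5), limit identified by Gibbs invariance and
Harris uniqueness), integrated against `|a| e^{ϑH} ≤ M_a e^{2ϑH} ∈ L¹(μ_T)`. Also: `a · (K_u g)` is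
`μ_T`-integrable. The constants depend on `n`. [cite: CuneoEckmannHairerReyBellet2018, Thm 2.13 (3)] -/
theorem pinnedChain_corr_exp_decay_and_integrable {ϑ : ℝ} (hϑ0 : 0 < ϑ) (h2ϑ : 2 * ϑ < 1 / T)
    {a g : PhaseSpace n → ℝ} (ha : Continuous a) (hg : Continuous g) {Ma Mg : ℝ}
    (haM : ∀ y, |a y| ≤ Ma * Real.exp (ϑ * (pinnedChain ω₂ lam β γ).hamiltonian n y))
    (hgM : ∀ y, |g y| ≤ Mg * Real.exp (ϑ * (pinnedChain ω₂ lam β γ).hamiltonian n y)) :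
    ∃ C c : ℝ, 0 < c ∧ ∀ u : ℝ, 0 ≤ u →
      Integrable (fun z => a z * ∫ y, g y ∂((pinnedChain ω₂ lam β γ).transitionKernel n T T u.toNNReal z))
        ((pinnedChain ω₂ lam β γ).gibbsMeasure n T) ∧
      |∫ z, a z * (∫ y, g y ∂((pinnedChain ω₂ lam β γ).transitionKernel n T T u.toNNReal z))
          ∂((pinnedChain ω₂ lam β γ).gibbsMeasure n T) -
        (∫ z, a z ∂((pinnedChain ω₂ lam β γ).gibbsMeasure n T)) *
          (∫ y, g y ∂((pinnedChain ω₂ lam β γ).gibbsMeasure n T))| ≤ C * Real.exp (-c * u) := by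
  set P := pinnedChain ω₂ lam β γ with hP
  set μ := P.gibbsMeasure n T with hμ
  have hϑ1 : ϑ < 1 / T := by linarith
  obtain ⟨C, c, hC, hc, hconv⟩ := pinnedChain_exp_convergence_gibbs hω hl hβ hγ hn hT hϑ0 hϑ1
  -- a positive domination constant for `g`
  set M : ℝ := max Mg 1 with hM
  have hM0 : 0 < M := lt_of_lt_of_le one_pos (le_max_right _ _)
  have hgM' : ∀ y, |g y| ≤ M * Real.exp (ϑ * P.hamiltonian n y) := fun y =>
    (hgM y).trans (mul_le_mul_of_nonneg_right (le_max_left _ _) (Real.exp_pos _).le)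
  set mg : ℝ := ∫ y, g y ∂μ with hmg
  -- the weight `|a| e^{ϑH} ≤ M_a e^{2ϑH}` is `μ_T`-integrable, and so is `a`
  have hexp2 := pinnedChain_integrable_exp_mul_hamiltonian_gibbsMeasure hω hl hβ.le γ n hT h2ϑ
  have hexp1 := pinnedChain_integrable_exp_mul_hamiltonian_gibbsMeasure hω hl hβ.le γ n hT hϑ1
  have hwint : Integrable (fun z => |a z| * Real.exp (ϑ * P.hamiltonian n z)) μ := by
    refine (hexp2.const_mul Ma).mono' ((continuous_abs.comp ha).mul (Real.continuous_exp.comp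
      (continuous_const.mul (pinnedChain_continuous_hamiltonian ω₂ lam β γ n)))).aestronglyMeasurable
      (Eventually.of_forall fun z => ?_)
    rw [Real.norm_eq_abs, abs_mul, abs_abs, abs_of_pos (Real.exp_pos _)]
    calc |a z| * Real.exp (ϑ * P.hamiltonian n z) ≤ (Ma * Real.exp (ϑ * P.hamiltonian n z)) *
        Real.exp (ϑ * P.hamiltonian n z) := mul_le_mul_of_nonneg_right (haM z) (Real.exp_pos _).le
      _ = Ma * Real.exp (2 * ϑ * P.hamiltonian n z) := by rw [mul_assoc, ← Real.exp_add]; ring_nf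
  have haint : Integrable a μ := integrable_of_abs_le_exp hexp1 ha haM
  set W : ℝ := ∫ z, |a z| * Real.exp (ϑ * P.hamiltonian n z) ∂μ with hW
  refine ⟨M * C * W, c, hc, fun u hu => ?_⟩
  set Kg : PhaseSpace n → ℝ := fun z => ∫ y, g y ∂(P.transitionKernel n T T u.toNNReal z) with hKg
  have hKgm : StronglyMeasurable Kg :=
    hg.stronglyMeasurable.integral_kernel (κ := P.transitionKernel n T T u.toNNReal)
  -- pointwise decay of `K_u g - μ_T(g)`
  have hpt : ∀ z, |Kg z - mg| ≤ M * C * Real.exp (ϑ * P.hamiltonian n z) * Real.exp (-c * u) := by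
    intro z
    have hf : Continuous fun y => M⁻¹ * g y := continuous_const.mul hg
    have hfb : ∀ y, |M⁻¹ * g y| ≤ Real.exp (ϑ * P.hamiltonian n y) := fun y => by
      rw [abs_mul, abs_of_pos (inv_pos.2 hM0), inv_mul_le_iff₀ hM0]
      exact hgM' y
    have h := hconv z u.toNNReal _ hf hfb
    rw [integral_const_mul, integral_const_mul, ← mul_sub, abs_mul,
      abs_of_pos (inv_pos.2 hM0), inv_mul_le_iff₀ hM0, Real.coe_toNNReal _ hu] at h
    calc |Kg z - mg| ≤ M * (C * Real.exp (ϑ * P.hamiltonian n z) * Real.exp (-c * u)) := h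
      _ = M * C * Real.exp (ϑ * P.hamiltonian n z) * Real.exp (-c * u) := by ring
  -- `a · (K_u g - μ_T(g))` is dominated by an integrable weight
  have hbound : ∀ z, ‖a z * (Kg z - mg)‖ ≤
      M * C * Real.exp (-c * u) * (|a z| * Real.exp (ϑ * P.hamiltonian n z)) := fun z => by
    rw [Real.norm_eq_abs, abs_mul]
    calc |a z| * |Kg z - mg|
        ≤ |a z| * (M * C * Real.exp (ϑ * P.hamiltonian n z) * Real.exp (-c * u)) :=
          mul_le_mul_of_nonneg_left (hpt z) (abs_nonneg _)
      _ = M * C * Real.exp (-c * u) * (|a z| * Real.exp (ϑ * P.hamiltonian n z)) := by ring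
  have hdiff : Integrable (fun z => a z * (Kg z - mg)) μ :=
    (hwint.const_mul (M * C * Real.exp (-c * u))).mono'
      (ha.aestronglyMeasurable.mul (hKgm.aestronglyMeasurable.sub aestronglyMeasurable_const))
      (Eventually.of_forall hbound)
  have hprod : Integrable (fun z => a z * Kg z) μ := by
    have h := hdiff.add (haint.mul_const mg)
    refine h.congr (Eventually.of_forall fun z => ?_)
    simp only [Pi.add_apply]
    ring
  refine ⟨hprod, ?_⟩
  have hsplit : (∫ z, a z * Kg z ∂μ) - (∫ z, a z ∂μ) * mg = ∫ z, a z * (Kg z - mg) ∂μ := by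
    rw [← integral_mul_const, ← integral_sub hprod (haint.mul_const mg)]
    refine integral_congr_ae (Eventually.of_forall fun z => ?_)
    ring
  have := norm_integral_le_of_norm_le (hwint.const_mul (M * C * Real.exp (-c * u)))
    (Eventually.of_forall hbound)
  rw [integral_const_mul, Real.norm_eq_abs] at this
  rw [hsplit]
  calc _ ≤ M * C * Real.exp (-c * u) * W := this
    _ = M * C * W * Real.exp (-c * u) := by ring

/-- **Exponential decorrelation at fixed length** (the estimate alone):
`|∫ a (K_u g) dμ_T - (∫ a dμ_T)(∫ g dμ_T)| ≤ C e^{-cu}` for `u ≥ 0`, with `c > 0`.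
[cite: CuneoEckmannHairerReyBellet2018, Thm 2.13 (3)] -/
theorem pinnedChain_corr_exp_decay {ϑ : ℝ} (hϑ0 : 0 < ϑ) (h2ϑ : 2 * ϑ < 1 / T)
    {a g : PhaseSpace n → ℝ} (ha : Continuous a) (hg : Continuous g) {Ma Mg : ℝ}
    (haM : ∀ y, |a y| ≤ Ma * Real.exp (ϑ * (pinnedChain ω₂ lam β γ).hamiltonian n y))
    (hgM : ∀ y, |g y| ≤ Mg * Real.exp (ϑ * (pinnedChain ω₂ lam β γ).hamiltonian n y)) :
    ∃ C c : ℝ, 0 < c ∧ ∀ u : ℝ, 0 ≤ u →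
      |∫ z, a z * (∫ y, g y ∂((pinnedChain ω₂ lam β γ).transitionKernel n T T u.toNNReal z))
          ∂((pinnedChain ω₂ lam β γ).gibbsMeasure n T) -
        (∫ z, a z ∂((pinnedChain ω₂ lam β γ).gibbsMeasure n T)) *
          (∫ y, g y ∂((pinnedChain ω₂ lam β γ).gibbsMeasure n T))| ≤ C * Real.exp (-c * u) := by
  obtain ⟨C, c, hc, h⟩ := pinnedChain_corr_exp_decay_and_integrable hω hl hβ hγ hn hT hϑ0 h2ϑ ha hg haM hgM
  exact ⟨C, c, hc, fun u hu => (h u hu).2⟩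

/-- `a · (K_u g)` is `μ_T`-integrable for every `u ≥ 0` (same hypotheses). [folklore] -/
theorem pinnedChain_integrable_weight_mul_act {ϑ : ℝ} (hϑ0 : 0 < ϑ) (h2ϑ : 2 * ϑ < 1 / T)
    {a g : PhaseSpace n → ℝ} (ha : Continuous a) (hg : Continuous g) {Ma Mg : ℝ}
    (haM : ∀ y, |a y| ≤ Ma * Real.exp (ϑ * (pinnedChain ω₂ lam β γ).hamiltonian n y))
    (hgM : ∀ y, |g y| ≤ Mg * Real.exp (ϑ * (pinnedChain ω₂ lam β γ).hamiltonian n y)) (u : ℝ≥0) :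
    Integrable (fun z => a z * ∫ y, g y ∂((pinnedChain ω₂ lam β γ).transitionKernel n T T u z))
      ((pinnedChain ω₂ lam β γ).gibbsMeasure n T) := by
  obtain ⟨C, c, -, h⟩ := pinnedChain_corr_exp_decay_and_integrable hω hl hβ hγ hn hT hϑ0 h2ϑ ha hg haM hgM
  have := (h u u.coe_nonneg).1
  rwa [Real.toNNReal_coe] at this

omit hn in
/-- `u ↦ ∫ a (K_{u⁺} g) dμ_T` is a measurable function of time for continuous `a`, `g` (joint
measurability of the constructed transition kernels in `(t, z)`). [folklore] -/
theorem pinnedChain_measurable_corr {a g : PhaseSpace n → ℝ} (ha : Continuous a) (hg : Continuous g) :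
    Measurable fun u : ℝ => ∫ z, a z *
        (∫ y, g y ∂((pinnedChain ω₂ lam β γ).transitionKernel n T T u.toNNReal z))
      ∂((pinnedChain ω₂ lam β γ).gibbsMeasure n T) := by
  set P := pinnedChain ω₂ lam β γ with hP
  set μ := P.gibbsMeasure n T with hμ
  haveI : IsProbabilityMeasure μ := pinnedChain_isProbabilityMeasure_gibbsMeasure hω hl hβ.le γ n hT
  -- the kernels as ONE kernel on `ℝ≥0 × Ω`
  let κ₂ : Kernel (ℝ≥0 × PhaseSpace n) (PhaseSpace n) :=
    { toFun := fun p => P.transitionKernel n T T p.1 p.2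
      measurable' := pinnedChain_measurable_transitionKernel hω hl hβ.le hγ.le n T T }
  have hG : StronglyMeasurable fun p : ℝ≥0 × PhaseSpace n => ∫ y, g y ∂(κ₂ p) :=
    hg.stronglyMeasurable.integral_kernel (κ := κ₂)
  have hF : StronglyMeasurable fun q : ℝ × PhaseSpace n =>
      a q.2 * ∫ y, g y ∂(P.transitionKernel n T T q.1.toNNReal q.2) := by
    have h1 : StronglyMeasurable fun q : ℝ × PhaseSpace n => a q.2 :=
      (ha.comp continuous_snd).stronglyMeasurable
    have h2 : StronglyMeasurable fun q : ℝ × PhaseSpace n => ∫ y, g y ∂(κ₂ (q.1.toNNReal, q.2)) :=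
      hG.comp_measurable ((measurable_real_toNNReal.comp measurable_fst).prodMk measurable_snd)
    exact h1.mul h2
  exact (hF.integral_prod_right' (ν := μ)).measurable

/-- **Centred correlations are integrable on `(0, ∞)`**: if `∫ g dμ_T = 0` then
`u ↦ ∫ a (K_u g) dμ_T ∈ L¹(0, ∞)` (measurability and exponential decay). [folklore] -/
theorem pinnedChain_corr_integrableOn {ϑ : ℝ} (hϑ0 : 0 < ϑ) (h2ϑ : 2 * ϑ < 1 / T)
    {a g : PhaseSpace n → ℝ} (ha : Continuous a) (hg : Continuous g) {Ma Mg : ℝ}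
    (haM : ∀ y, |a y| ≤ Ma * Real.exp (ϑ * (pinnedChain ω₂ lam β γ).hamiltonian n y))
    (hgM : ∀ y, |g y| ≤ Mg * Real.exp (ϑ * (pinnedChain ω₂ lam β γ).hamiltonian n y))
    (h0 : ∫ y, g y ∂((pinnedChain ω₂ lam β γ).gibbsMeasure n T) = 0) :
    IntegrableOn (fun u : ℝ => ∫ z, a z *
        (∫ y, g y ∂((pinnedChain ω₂ lam β γ).transitionKernel n T T u.toNNReal z))
      ∂((pinnedChain ω₂ lam β γ).gibbsMeasure n T)) (Ioi 0) := by
  obtain ⟨C, c, hc, hb⟩ := pinnedChain_corr_exp_decay hω hl hβ hγ hn hT hϑ0 h2ϑ ha hg haM hgM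
  refine Integrable.mono' ((exp_neg_integrableOn_Ioi 0 hc).const_mul C)
    (pinnedChain_measurable_corr hω hl hβ hγ hT ha hg).aestronglyMeasurable ?_
  refine (ae_restrict_iff' measurableSet_Ioi).2 (Eventually.of_forall fun u hu => ?_)
  have h := hb u (le_of_lt hu)
  rw [h0, mul_zero, sub_zero] at h
  rwa [Real.norm_eq_abs]

/-- **Squares of centred correlations are integrable on `(0, ∞)`**: if `∫ g dμ_T = 0` then
`u ↦ (∫ a (K_u g) dμ_T)² ∈ L¹(0, ∞)`. [folklore] -/
theorem pinnedChain_corr_sq_integrableOn {ϑ : ℝ} (hϑ0 : 0 < ϑ) (h2ϑ : 2 * ϑ < 1 / T)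
    {a g : PhaseSpace n → ℝ} (ha : Continuous a) (hg : Continuous g) {Ma Mg : ℝ}
    (haM : ∀ y, |a y| ≤ Ma * Real.exp (ϑ * (pinnedChain ω₂ lam β γ).hamiltonian n y))
    (hgM : ∀ y, |g y| ≤ Mg * Real.exp (ϑ * (pinnedChain ω₂ lam β γ).hamiltonian n y))
    (h0 : ∫ y, g y ∂((pinnedChain ω₂ lam β γ).gibbsMeasure n T) = 0) :
    IntegrableOn (fun u : ℝ => (∫ z, a z *
        (∫ y, g y ∂((pinnedChain ω₂ lam β γ).transitionKernel n T T u.toNNReal z))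
      ∂((pinnedChain ω₂ lam β γ).gibbsMeasure n T)) ^ 2) (Ioi 0) := by
  obtain ⟨C, c, hc, hb⟩ := pinnedChain_corr_exp_decay hω hl hβ hγ hn hT hϑ0 h2ϑ ha hg haM hgM
  have h2c : 0 < 2 * c := by positivity
  refine Integrable.mono' ((exp_neg_integrableOn_Ioi 0 h2c).const_mul (C ^ 2))
    ((pinnedChain_measurable_corr hω hl hβ hγ hT ha hg).pow_const 2).aestronglyMeasurable ?_
  refine (ae_restrict_iff' measurableSet_Ioi).2 (Eventually.of_forall fun u hu => ?_)
  have h := hb u (le_of_lt hu)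
  rw [h0, mul_zero, sub_zero] at h
  rw [Real.norm_eq_abs, abs_pow, sq_abs]
  calc (∫ z, a z * (∫ y, g y ∂((pinnedChain ω₂ lam β γ).transitionKernel n T T u.toNNReal z))
        ∂((pinnedChain ω₂ lam β γ).gibbsMeasure n T)) ^ 2
      ≤ (C * Real.exp (-c * u)) ^ 2 := by
        rw [← sq_abs]
        exact pow_le_pow_left₀ (abs_nonneg _) h 2
    _ = C ^ 2 * Real.exp (-(2 * c) * u) := by
        rw [mul_pow, ← Real.exp_nat_mul]; ring_nf

end Corr

end Summit.AtomisticToContinuum.FouriersLaw.Theorems.CoherentDephasing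

end
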